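import Literature.AlgebraicGeometry.HodgeTheory.ComplexGysinCorrespondence
import Literature.AlgebraicGeometry.HodgeTheory.SupportedHodgeClassDescent
import Literature.AlgebraicTopology.SingularHomology.GysinMapSupportProofs
import HarnessLib

/-!
# The action of a graph class: push–pull `[(f, g)₊ 1]_* = f₊ ∘ g^*` (Fulton, *Intersection Theory*,
# §16.1)

Family `hodge`, layer `Literature/AlgebraicGeometry/HodgeTheory`. For smooth projective complex
varieties `S` (dimension `d`) and `X` (dimension `n`) and two morphisms `f g : S ⟶ X`, the class
`γ = (f, g)₊ 1 ∈ H^{2e}((X ⊗ X)(ℂ); ℂ)`, `d + e = 2n` — the Gysin image of `1 ∈ H⁰(S(ℂ); ℂ)` under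
`lift f g : S ⟶ X ⊗ X`, i.e. the class of the cycle `(f, g)_*[S]` (the graph of the correspondence)
— acts through the tree's correspondence action `corrAction μ` (`[γ]_* β = pr₁₊(pr₂^* β ∪ γ)`,
file `ComplexGysinCorrespondence`) as the push–pull operator `f₊ ∘ g^*`:

* W. Fulton, *Intersection Theory* (2nd ed. 1998), §16.1, Prop. 16.1.1 with Def. 16.1.2: a
  correspondence `α` from `X` to `Y` acts by `α_*(x) = p_{Y*}(p_X^* x · α)`; for the graph `Γ_f` of a
  morphism this is `f_*`, for its transpose `f^*` (Prop. 16.1.2 (c)); for the push-forward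
  `(f, g)_*[S]` of a smooth `S` mapping to both factors it is `f_* g^*` by the projection formula.
* The case `S = X`, `f = g = 𝟙` is the diagonal, acting as the identity (Fulton Ex. 16.1.3;
  the tree's `…ImpureBarrenEnvelope.corrAction_gysinDiagonal_one`, Summits side).

## What is proved

* `corrAction_gysinGraph_one` — **push–pull**: `corrAction μ hX hX hab ((f, g)₊ 1) = f₊ ∘ g^*` for
  every orientation family `μ` with Poincaré duality (projection formula `complexGysin_cup` for
  `lift f g` read right to left, `∪ 1 = id`, `(f, g) ≫ pr₂ = g`, functoriality `complexGysin_comp` and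
  `(f, g) ≫ pr₁ = f`); exact, no orientation scalar.
* `gysinGraph_one_mem_algebraicClasses` — `(f, g)₊ 1 ∈ Nᵉ H^{2e}((X ⊗ X)(ℂ); ℂ)` is algebraic
  (`complexGysin_mem_supportedClasses` with the proved support property
  `gysinMap_restrictCompl_eq_zero_of_field ℂ`: proper push-forward shifts the coniveau by the relative
  dimension, and `1 ∈ N⁰ H⁰ = H⁰`).
* `exists_algebraic_corrAction_eq_of_pushPull` — hence every operator `c • f₊ g^*` on `Hᵃ(X(ℂ); ℂ)`
  with `dim S = dim X` is the action of an ALGEBRAIC self-correspondence `γ ∈ Nⁿ H²ⁿ((X ⊗ X)(ℂ))`.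

Consumer: Hecke operators of compact ball quotients as actions of algebraic self-correspondences
(route HodgeConjecture/EndoscopicMiddleDegree, crux `OrthogonalEnveloped`, line
`impure-barren-envelope`: once the Hecke level covers are available as smooth projective schemes with
their two finite étale projections, `T_g = c • π₊ π'^*` is `[γ]_*` for an algebraic `γ`).

## What is NOT here

Composition of such actions (file `CorrespondenceComposition`, `corr_comp_of_baseChange`) and the
algebraicity of Hecke correspondences (Baily–Borel; not in the tree).

## References

* [Fulton1998] W. Fulton, *Intersection Theory*, 2nd ed., Springer 1998, §16.1 Prop. 16.1.1,
  Def. 16.1.2, Prop. 16.1.2.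
* [FultonYoungTableaux1997] W. Fulton, *Young Tableaux*, CUP 1997, Appendix B §B.1 (5)–(6), §B.2
  Exercise 5, §B.3 (Gysin maps, projection formula, the class of a subvariety as `φ_* 1`).
-/

noncomputable section

open CategoryTheory MonoidalCategory CartesianMonoidalCategory

namespace Literature.AlgebraicGeometry.HodgeTheory

section HodgeTheory

open Literature.AlgebraicTopology.SingularHomology

variable {μ : OrientationFamily} {d n : ℕ} {S X : Motives.SchemeOver ℂ}

/-- **Push–pull for a graph class** (Fulton §16.1: the correspondence `(f, g)_*[S]` acts by
`f_* ∘ g^*`). For smooth projective `S`, `X` of dimensions `d`, `n`, morphisms `f g : S ⟶ X` and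
`d + e = n + n`, the Gysin image `γ = (f, g)₊ 1 ∈ H^{2e}((X ⊗ X)(ℂ); ℂ)` of `1 ∈ H⁰(S(ℂ); ℂ)` under
`lift f g : S ⟶ X ⊗ X` acts on `Hᵃ(X(ℂ); ℂ)` by `[γ]_* β = pr₁₊(pr₂^* β ∪ (f,g)₊ 1) = f₊ (g^* β)`:
projection formula `pr₂^* β ∪ (f,g)₊ 1 = (f,g)₊((f,g)^* pr₂^* β ∪ 1)` (`complexGysin_cup`),
`∪ 1 = id`, `(f,g)^* pr₂^* = g^*` (`lift_snd`) and `pr₁₊ (f,g)₊ = ((f,g) ≫ pr₁)₊ = f₊`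
(`complexGysin_comp`, `lift_fst`). Exact for every orientation family with Poincaré duality.
[cite: Fulton1998, §16.1 Prop. 16.1.1 and Def. 16.1.2] -/
theorem corrAction_gysinGraph_one (hμ : μ.HasPoincareDuality)
    (hS : Motives.IsSmoothProjective d S) (hX : Motives.IsSmoothProjective n X)
    (f g : S ⟶ X) {e a b : ℕ} (hde : d + e = n + n) (hab : a + 2 * e = b + 2 * n) :
    corrAction μ hX hX hab
        (complexGysin μ hS (Motives.IsSmoothProjective.tensor_holds hX hX) (lift f g)
          (show 0 + 2 * (n + n) = 2 * e + 2 * d by omega)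
          (singularCohomology.one ℂ (Motives.ComplexPoints S))) =
      complexGysin μ hS hX f (show a + 2 * n = b + 2 * d by omega) ∘ₗ (complexBetti.map g a).hom := by
  have hXX := Motives.IsSmoothProjective.tensor_holds hX hX
  refine LinearMap.ext fun β => ?_
  rw [corrAction_apply, LinearMap.comp_apply,
    ← complexGysin_cup hμ hS hXX (lift f g) (Nat.add_zero a)
      (show a + 2 * (n + n) = a + 2 * e + 2 * d by omega)
      (show 0 + 2 * (n + n) = 2 * e + 2 * d by omega) rfl
      (complexBetti.map (snd X X) a β) (singularCohomology.one ℂ (Motives.ComplexPoints S)),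
    cupProduct_one, ← CategoryTheory.comp_apply, ← complexBetti.map_comp, lift_snd,
    ← LinearMap.comp_apply (f := complexGysin μ hXX hX (fst X X) _),
    ← complexGysin_comp hμ hS hXX hX (lift f g) (fst X X)]
  simp only [lift_fst]

variable (μ) in
/-- **Graph classes are algebraic**: for smooth projective `S`, `X` of dimensions `d`, `n`,
`f g : S ⟶ X` and `d + e = n + n`, `(f, g)₊ 1 ∈ Nᵉ H^{2e}((X ⊗ X)(ℂ); ℂ) = algebraicClasses (X ⊗ X) e`
(the class `φ_* 1` of the image of `φ = (f, g)`: proper push-forward shifts the coniveau filtration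
by the relative dimension, `complexGysin_mem_supportedClasses` with the proved support property
`gysinMap_restrictCompl_eq_zero_of_field ℂ`, and `1 ∈ N⁰ H⁰ = H⁰`).
[cite: FultonYoungTableaux1997, Appendix B §B.2 Exercise 5 and §B.3] -/
theorem gysinGraph_one_mem_algebraicClasses (hμ : μ.HasPoincareDuality)
    (hS : Motives.IsSmoothProjective d S) (hX : Motives.IsSmoothProjective n X) (f g : S ⟶ X)
    {e : ℕ} (hde : d + e = n + n) :
    complexGysin μ hS (Motives.IsSmoothProjective.tensor_holds hX hX) (lift f g)
        (show 0 + 2 * (n + n) = 2 * e + 2 * d by omega)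
        (singularCohomology.one ℂ (Motives.ComplexPoints S)) ∈ algebraicClasses (X ⊗ X) e :=
  complexGysin_mem_supportedClasses (gysinMap_restrictCompl_eq_zero_of_field ℂ) μ hμ hS
    (Motives.IsSmoothProjective.tensor_holds hX hX) (lift f g) _ (r := 0) (by omega)
    (by rw [supportedClasses_zero]; exact Submodule.mem_top)

/-- **Push–pull operators are actions of algebraic self-correspondences**: for `μ` with Poincaré
duality, `X` smooth projective of dimension `n`, and an operator `T = c • f₊ g^*` on `Hᵃ(X(ℂ); ℂ)`
through a smooth projective `S` of the same dimension `n` and `f g : S ⟶ X`, there is an algebraic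
`γ ∈ Nⁿ H²ⁿ((X ⊗ X)(ℂ); ℂ)` with `[γ]_* = T`, namely `γ = c • (f, g)₊ 1` (the case of a Hecke
correspondence presented on a level cover `S` with its two finite étale projections).
[cite: Fulton1998, §16.1 Prop. 16.1.1 and Def. 16.1.2] -/
theorem exists_algebraic_corrAction_eq_of_pushPull (hμ : μ.HasPoincareDuality)
    (hX : Motives.IsSmoothProjective n X) {a : ℕ} {T : complexBetti X a →ₗ[ℂ] complexBetti X a}
    (hT : ∃ (S : Motives.SchemeOver ℂ) (hS : Motives.IsSmoothProjective n S) (f g : S ⟶ X) (c : ℂ),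
      T = c • (complexGysin μ hS hX f (rfl : a + 2 * n = a + 2 * n) ∘ₗ (complexBetti.map g a).hom)) :
    ∃ γ ∈ algebraicClasses (X ⊗ X) n,
      corrAction μ hX hX (rfl : a + 2 * n = a + 2 * n) γ = T := by
  obtain ⟨S, hS, f, g, c, rfl⟩ := hT
  refine ⟨c • complexGysin μ hS (Motives.IsSmoothProjective.tensor_holds hX hX) (lift f g)
      (show 0 + 2 * (n + n) = 2 * n + 2 * n by omega)
      (singularCohomology.one ℂ (Motives.ComplexPoints S)),
    Submodule.smul_mem _ c (gysinGraph_one_mem_algebraicClasses μ hμ hS hX f g rfl), ?_⟩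
  rw [map_smul, corrAction_gysinGraph_one hμ hS hX f g rfl rfl]

end HodgeTheory

end Literature.AlgebraicGeometry.HodgeTheory

end
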